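import Literature.AlgebraicGeometry.Frobenioids.ArithmeticFrobenioids
import HarnessLib

/-!
# Frobenioids I, Example 6.3: `Prime(Φ(L)) ≃ V(L)` for the monoid of effective arithmetic divisors — PROOF

Mochizuki, *The geometry of Frobenioids I*, Kyushu J. Math. **62** (2008), Example 6.3, kurims p. 113: "Thus
[cf. §0], `φ ≠ 0` is perf-factorial, … and there is a natural bijection `Prime(Φ(L)) ≃ V(L)`"; the primes
of a monoid are the `≼`-classes of its primary elements (§0 p. 12). [cite: MochizukiFrdI2008, Ex. 6.3 p.113]

PROVED here (seat abc-iut-L6-t10) — abc-iut-L1-t3's named statement `Ex63_primes L` (the explicit map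
`v ↦ [δ_v]`, `δ_v` the effective divisor with coefficient `1` at `v`, is well defined and bijective): for
effective arithmetic divisors `D ≼ E` iff `supp D ⊆ supp E` (`precsim_iff_psupp_subset`), so the primary
elements are exactly the nonzero divisors supported at a single place (`isPrimary_iff`) and their
`≼`-classes are classified by that place (`Ex63_primes_holds`). Over abc-iut-L1-t3's `ArithmeticDivisors.lean`
(`EffArithDivisor L = (FinitePlace L →₀ ℕ) × (InfinitePlace L → ℝ≥0)`) and the tree's `Monoids.lean`
(`Precsim`, `IsPrimary`, `Primes`).
-/

noncomputable section

namespace Literature.AlgebraicGeometry.Frobenioids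

open NumberField

namespace EffArithDivisor

variable {L : Type} [Field L] [NumberField L]

/-- The support of an effective arithmetic divisor, as a set of places (`V(L) = V(L)_arc ⊔ V(L)_non`).
[cite: MochizukiFrdI2008, Ex. 6.3 p.113] -/
def psupp (D : EffArithDivisor L) : Set (Places L) :=
  {p | Sum.elim (fun w => D.2 w ≠ 0) (fun v => D.1 v ≠ 0) p}

/-- Membership of an archimedean place in the support. [cite: MochizukiFrdI2008, Ex. 6.3 p.113] -/
@[simp] theorem inl_mem_psupp {D : EffArithDivisor L} {w : InfinitePlace L} :
    (Sum.inl w : Places L) ∈ psupp D ↔ D.2 w ≠ 0 := Iff.rfl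

/-- Membership of a nonarchimedean place in the support. [cite: MochizukiFrdI2008, Ex. 6.3 p.113] -/
@[simp] theorem inr_mem_psupp {D : EffArithDivisor L} {v : FinitePlace L} :
    (Sum.inr v : Places L) ∈ psupp D ↔ D.1 v ≠ 0 := Iff.rfl

/-- The support is empty iff the divisor is zero. [cite: MochizukiFrdI2008, Ex. 6.3 p.113] -/
theorem psupp_eq_empty_iff {D : EffArithDivisor L} : psupp D = ∅ ↔ D = 0 := by
  constructor
  · intro h
    refine Prod.ext (Finsupp.ext fun v => ?_) (funext fun w => ?_)
    · by_contra hv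
      have : (Sum.inr v : Places L) ∈ psupp D := hv
      rw [h] at this
      exact this
    · by_contra hw
      have : (Sum.inl w : Places L) ∈ psupp D := hw
      rw [h] at this
      exact this
  · rintro rfl
    ext p
    rcases p with w | v <;> simp

/-- The support of the divisor `δ_p` with coefficient `1` at `p` is `{p}`. [cite: MochizukiFrdI2008, Ex. 6.3 p.113] -/
theorem psupp_single (p : Places L) : psupp (EffArithDivisor.single L p) = {p} := by
  classical
  ext q
  rcases p with w | v <;> rcases q with w' | v'
  · simp [EffArithDivisor.single, psupp]
  · simp [EffArithDivisor.single, psupp]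
  · simp [EffArithDivisor.single, psupp]
  · simp only [EffArithDivisor.single, inr_mem_psupp, Set.mem_singleton_iff, Sum.inr.injEq, ne_eq,
      Finsupp.single_apply]
    by_cases h : v = v' <;> simp [h, eq_comm]

/-- Divisibility in `Φ(L)` (written multiplicatively) is the componentwise order.
[cite: MochizukiFrdI2008, Ex. 6.3 p.113] -/
theorem ofAdd_dvd_ofAdd_iff {D E : EffArithDivisor L} :
    Multiplicative.ofAdd D ∣ Multiplicative.ofAdd E ↔ (∀ v, D.1 v ≤ E.1 v) ∧ ∀ w, D.2 w ≤ E.2 w := by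
  constructor
  · rintro ⟨x, hx⟩
    have hE : E = D + Multiplicative.toAdd x := by
      have := congrArg Multiplicative.toAdd hx
      simpa using this
    refine ⟨fun v => ?_, fun w => ?_⟩
    · rw [hE]; exact le_self_add
    · rw [hE]; exact le_self_add
  · rintro ⟨h1, h2⟩
    refine ⟨Multiplicative.ofAdd (E.1 - D.1, fun w => E.2 w - D.2 w), ?_⟩
    rw [← ofAdd_add]
    congr 1
    refine Prod.ext (Finsupp.ext fun v => ?_) (funext fun w => ?_)
    · simp only [Prod.fst_add, Finsupp.coe_add, Finsupp.coe_tsub, Pi.add_apply, Pi.sub_apply]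
      exact (add_tsub_cancel_of_le (h1 v)).symm
    · simp only [Prod.snd_add, Pi.add_apply]
      exact (add_tsub_cancel_of_le (h2 w)).symm

/-- **`D ≼ E` iff `supp D ⊆ supp E`** for effective arithmetic divisors: `D ≤ n·E` for `n` large as soon as
`E` is positive wherever `D` is. [cite: MochizukiFrdI2008, Ex. 6.3 p.113] -/
theorem precsim_iff_psupp_subset {D E : EffArithDivisor L} :
    Precsim (Multiplicative.ofAdd D) (Multiplicative.ofAdd E) ↔ psupp D ⊆ psupp E := by
  constructor
  · rintro ⟨n, -, hdvd⟩
    rw [← ofAdd_nsmul, ofAdd_dvd_ofAdd_iff] at hdvd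
    intro p hp
    rcases p with w | v
    · rw [inl_mem_psupp] at hp ⊢
      intro h0
      have := hdvd.2 w
      rw [Prod.smul_snd, Pi.smul_apply, h0, smul_zero, nonpos_iff_eq_zero] at this
      exact hp this
    · rw [inr_mem_psupp] at hp ⊢
      intro h0
      have := hdvd.1 v
      rw [Prod.smul_fst, Finsupp.smul_apply, h0, smul_zero, nonpos_iff_eq_zero] at this
      exact hp this
  · intro h
    -- a uniform bound `n`
    let n : ℕ := (D.1.sum fun _ c => c) + (∑ w, ⌈D.2 w / E.2 w⌉₊) + 1
    refine ⟨n, Nat.succ_pos _, ?_⟩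
    rw [← ofAdd_nsmul, ofAdd_dvd_ofAdd_iff]
    refine ⟨fun v => ?_, fun w => ?_⟩
    · rw [Prod.smul_fst, Finsupp.smul_apply, smul_eq_mul]
      by_cases hv : D.1 v = 0
      · rw [hv]; exact Nat.zero_le _
      · have hE : E.1 v ≠ 0 := (inr_mem_psupp.mp (h (inr_mem_psupp.mpr hv)))
        have h1 : D.1 v ≤ D.1.sum fun _ c => c :=
          Finset.single_le_sum (f := fun v => D.1 v) (fun _ _ => Nat.zero_le _)
            (Finsupp.mem_support_iff.mpr hv)
        calc D.1 v ≤ n := by omega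
          _ ≤ n * E.1 v := Nat.le_mul_of_pos_right n (Nat.pos_of_ne_zero hE)
    · rw [Prod.smul_snd, Pi.smul_apply, nsmul_eq_mul]
      by_cases hw : D.2 w = 0
      · rw [hw]; exact bot_le
      · have hE : E.2 w ≠ 0 := (inl_mem_psupp.mp (h (inl_mem_psupp.mpr hw)))
        have hEpos : 0 < E.2 w := pos_iff_ne_zero.mpr hE
        have h1 : (⌈D.2 w / E.2 w⌉₊ : NNReal) ≤ n := by
          have : ⌈D.2 w / E.2 w⌉₊ ≤ n := by
            have := Finset.single_le_sum (f := fun w => ⌈D.2 w / E.2 w⌉₊) (fun _ _ => Nat.zero_le _)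
              (Finset.mem_univ w)
            omega
          exact_mod_cast this
        have h2 : D.2 w / E.2 w ≤ n := (Nat.le_ceil _).trans h1
        rw [div_le_iff₀ hEpos] at h2
        exact h2

/-- **The primary elements of `Φ(L)` are the nonzero divisors supported at a single place.**
[cite: MochizukiFrdI2008, Ex. 6.3 p.113] -/
theorem isPrimary_iff {D : EffArithDivisor L} :
    IsPrimary (Multiplicative.ofAdd D) ↔ ∃ p, psupp D = {p} := by
  constructor
  · rintro ⟨hne, hmin⟩
    have hD : D ≠ 0 := fun h => hne (by rw [h]; rfl)
    obtain ⟨p, hp⟩ : (psupp D).Nonempty :=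
      Set.nonempty_iff_ne_empty.mpr (fun h => hD (psupp_eq_empty_iff.mp h))
    refine ⟨p, Set.eq_singleton_iff_unique_mem.mpr ⟨hp, fun q hq => ?_⟩⟩
    have hq1 : Multiplicative.ofAdd (EffArithDivisor.single L q) ≠ 1 := by
      intro h
      have : psupp (EffArithDivisor.single L q) = ∅ :=
        psupp_eq_empty_iff.mpr (Multiplicative.ofAdd.injective h)
      rw [psupp_single] at this
      exact Set.singleton_ne_empty q this
    have hle : Precsim (Multiplicative.ofAdd (EffArithDivisor.single L q)) (Multiplicative.ofAdd D) := by
      rw [precsim_iff_psupp_subset, psupp_single, Set.singleton_subset_iff]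
      exact hq
    have := hmin _ hq1 hle
    rw [precsim_iff_psupp_subset, psupp_single, Set.subset_singleton_iff] at this
    exact (this p hp).symm ▸ rfl
  · rintro ⟨p, hp⟩
    refine ⟨fun h => ?_, fun b hb hle => ?_⟩
    · have : psupp D = ∅ := psupp_eq_empty_iff.mpr (Multiplicative.ofAdd.injective h)
      rw [hp] at this
      exact Set.singleton_ne_empty p this
    · have hb' : psupp (Multiplicative.toAdd b) ≠ ∅ := fun h =>
        hb (by rw [← ofAdd_toAdd b, psupp_eq_empty_iff.mp h]; rfl)
      rw [← ofAdd_toAdd b, precsim_iff_psupp_subset] at hle ⊢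
      rw [hp] at hle ⊢
      obtain ⟨q, hq⟩ := Set.nonempty_iff_ne_empty.mpr hb'
      have hqp : q = p := hle hq
      intro x hx
      rw [Set.mem_singleton_iff.mp hx, ← hqp]
      exact hq

/-- `δ_p` is primary. [cite: MochizukiFrdI2008, Ex. 6.3 p.113] -/
theorem isPrimary_single (p : Places L) : IsPrimary (Multiplicative.ofAdd (EffArithDivisor.single L p)) :=
  isPrimary_iff.mpr ⟨p, psupp_single p⟩

end EffArithDivisor

open EffArithDivisor in
/-- **Example 6.3: "there is a natural bijection `Prime(Φ(L)) ≃ V(L)`"** (FrdI p. 113) — abc-iut-L1-t3's named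
statement `Ex63_primes L` PROVED: `v ↦ [δ_v]` is a well-defined bijection from the places of `L` onto the primes
(`≼`-classes of primary elements, §0 p. 12) of the monoid of effective arithmetic divisors.
[cite: MochizukiFrdI2008, Ex. 6.3 p.113] -/
theorem Ex63_primes_holds (L : Type) [Field L] [NumberField L] : Ex63_primes L := by
  refine ⟨isPrimary_single, fun p q h => ?_, fun 𝔭 => ?_⟩
  · have h' : Precsim (Multiplicative.ofAdd (EffArithDivisor.single L p))
        (Multiplicative.ofAdd (EffArithDivisor.single L q)) := Quotient.exact h
    rw [precsim_iff_psupp_subset, psupp_single, psupp_single, Set.singleton_subset_iff,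
      Set.mem_singleton_iff] at h'
    exact h'
  · induction 𝔭 using Quotient.ind with
    | _ a =>
      obtain ⟨a, ha⟩ := a
      obtain ⟨p, hp⟩ := isPrimary_iff.mp (show IsPrimary (Multiplicative.ofAdd (Multiplicative.toAdd a)) from ha)
      refine ⟨p, Quotient.sound ?_⟩
      show Precsim (Multiplicative.ofAdd (EffArithDivisor.single L p)) a
      rw [← ofAdd_toAdd a, precsim_iff_psupp_subset, psupp_single, hp]

end Literature.AlgebraicGeometry.Frobenioids

end
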